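import Mathlib
import Summits.ValiantsHypothesis.ValiantsHypothesis.Theorems.ElementaryWordLengthWordLengthQPUnivariateWalk

/-!
# Crux `WordLengthQP` (stmt-ValiantsHypothesis-6623), line `positive-monoid-exits` —
THEOREM U, part 2/3: tap words and the sandwich identity (lead c6)

Value of a tap word (`utword_prod`): walk matrix plus garbage column `Σ_m ρ_m · W(2m) ⊗ e₂ᵀ`;
the sandwich identity (registered calibration stub `stub_univariateSandwichIdentity`): `R = Q₁ · E₀₂(F) · Q₂` as soon as the taps of `R` equal the
taps of `Q₁`, the walk-translated taps of `Q₂`, and `F · W(2J+1)`; the tap bookkeeping with positive /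
negative parts (`usplit`) and the two binomial totals (`utarget_odd`, `utarget_even`).

Vocabulary (written out in every statement; the files introduce NO definitions): the letter matrix
of `l = (i, j, c, o)` is `Matrix.transvection i j (C c * o.elim 1 X)` (the route's word predicate over
`σ = Fin 1`, `t = X 0`); a letter is POSITIVE ADJACENT (not an exit) iff `0 < c ∧ |i - j| = 1`; the TAPS
at a state are the letters `x₂(a) = (1,2,a,none)`, `x₂(b t) = (1,2,b,some 0)` written only when `a > 0`,
`b > 0`; a TAP WORD with `K` double steps is `taps(0) ++ ⋯ ++ [x₁(t)] ++ taps(k+1) ++ [y₁(t)] ++ ⋯`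
(`x₁(t) = (0,1,1,some 0)`, `y₁(t) = (1,0,1,some 0)`); the WALK MATRIX is `(x₁(t) y₁(t))^K`; the GARBAGE
COLUMN of a vector `v` is `vecMulVec v e₂`; the continuant STATE SEQUENCE is any
`W : ℕ → Fin 3 → ℝ[t]` with `W 0 = e₁, W 1 = e₀, W (n+2) = W n + t • W (n+1)` (hypothesis `hW`).

See part 1 (`…UnivariateWalk`) for the mechanism and references. [folklore]
-/

-- `Summit.ValiantsHypothesis.ValiantsHypothesis.…` is the tree's mandated single-conjunct layout
-- (Sub = Summit), so the duplicated namespace component is intended.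
set_option linter.dupNamespace false

noncomputable section

namespace Summit.ValiantsHypothesis.ValiantsHypothesis.Cruxes.WordLengthQP.PositiveMonoidExits

open Matrix

section TapWords

/-- The value of the taps `x₂(a) x₂(b t)` for `a, b ≥ 0`. [folklore] -/
theorem utaps_prod (a b : ℝ) (ha : 0 ≤ a) (hb : 0 ≤ b) :
    ((if (0 : ℝ) < a then [((1 : Fin 3), (2 : Fin 3), (a : ℝ), (none : Option (Fin 1)))] else []).map (fun l : Fin 3 × Fin 3 × ℝ × Option (Fin 1) =>
      Matrix.transvection l.1 l.2.1 (MvPolynomial.C l.2.2.1 * l.2.2.2.elim 1 MvPolynomial.X))).prod *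
    ((if (0 : ℝ) < b then [((1 : Fin 3), (2 : Fin 3), (b : ℝ), some (0 : Fin 1))] else []).map (fun l : Fin 3 × Fin 3 × ℝ × Option (Fin 1) =>
      Matrix.transvection l.1 l.2.1 (MvPolynomial.C l.2.2.1 * l.2.2.2.elim 1 MvPolynomial.X))).prod =
      Matrix.transvection 1 2 (MvPolynomial.C a + MvPolynomial.C b * (MvPolynomial.X (0 : Fin 1) : MvPolynomial (Fin 1) ℝ)) := by
  by_cases h0 : 0 < a <;> by_cases h1 : 0 < b
  · simp only [h0, h1, if_true, List.map_cons, List.map_nil,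
      List.prod_cons, List.prod_nil, mul_one, Option.elim_none, Option.elim_some]
    rw [Matrix.transvection_mul_transvection_same (1 : Fin 3) 2 (by decide)]
  · have hb0 : b = 0 := le_antisymm (not_lt.mp h1) hb
    subst hb0
    simp [h0]
  · have ha0 : a = 0 := le_antisymm (not_lt.mp h0) ha
    subst ha0
    simp [h1]
  · have ha0 : a = 0 := le_antisymm (not_lt.mp h0) ha
    have hb0 : b = 0 := le_antisymm (not_lt.mp h1) hb
    subst ha0; subst hb0
    simp

/-- The columns of the garbage matrix outside column 2 vanish. [folklore] -/
theorem uG_col (v : Fin 3 → (MvPolynomial (Fin 1) ℝ)) (i : Fin 3) (hi : i ≠ 2) : (fun r => Matrix.vecMulVec (v : Fin 3 → MvPolynomial (Fin 1) ℝ) (Pi.single (2 : Fin 3) (1 : MvPolynomial (Fin 1) ℝ)) r i) = 0 := by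
  funext r
  simp [Matrix.vecMulVec_apply, hi]

variable (W : ℕ → Fin 3 → MvPolynomial (Fin 1) ℝ)
  (hW : W 0 = Pi.single 1 1 ∧ W 1 = Pi.single 0 1 ∧
    ∀ n, W (n + 2) = W n + (MvPolynomial.X (0 : Fin 1) : MvPolynomial (Fin 1) ℝ) • W (n + 1))
include hW

/-- One more state in the garbage vector. [folklore] -/
theorem uvec_succ (τ0 τ1 : ℕ → ℝ) (K : ℕ) :
    (∑ m ∈ Finset.range (K + 1 + 1), (MvPolynomial.C ((τ0 : ℕ → ℝ) (m)) + MvPolynomial.C ((τ1 : ℕ → ℝ) (m)) * (MvPolynomial.X (0 : Fin 1) : MvPolynomial (Fin 1) ℝ)) • (W : ℕ → Fin 3 → MvPolynomial (Fin 1) ℝ) (2 * m)) = (∑ m ∈ Finset.range (K + 1), (MvPolynomial.C ((τ0 : ℕ → ℝ) (m)) + MvPolynomial.C ((τ1 : ℕ → ℝ) (m)) * (MvPolynomial.X (0 : Fin 1) : MvPolynomial (Fin 1) ℝ)) • (W : ℕ → Fin 3 → MvPolynomial (Fin 1) ℝ) (2 * m)) + (MvPolynomial.C ((τ0 : ℕ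 → ℝ) (K + 1)) + MvPolynomial.C ((τ1 : ℕ → ℝ) (K + 1)) * (MvPolynomial.X (0 : Fin 1) : MvPolynomial (Fin 1) ℝ)) • W (2 * K + 2) := by
  have _ := hW
  rw [Finset.sum_range_succ, show 2 * (K + 1) = 2 * K + 2 by ring]

/-- The garbage vector has vanishing third coordinate. [folklore] -/
theorem uvec_two (τ0 τ1 : ℕ → ℝ) (K : ℕ) : (∑ m ∈ Finset.range (K + 1), (MvPolynomial.C ((τ0 : ℕ → ℝ) (m)) + MvPolynomial.C ((τ1 : ℕ → ℝ) (m)) * (MvPolynomial.X (0 : Fin 1) : MvPolynomial (Fin 1) ℝ)) • (W : ℕ → Fin 3 → MvPolynomial (Fin 1) ℝ) (2 * m)) 2 = 0 := by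
  simp [Finset.sum_apply, ubW_two _ W hW]

/-- **Value of a tap word**: walk matrix plus garbage column `Σ_m ρ_m · W(2m)`. [folklore] -/
theorem utword_prod (τ0 τ1 : ℕ → ℝ) (h0 : ∀ m, 0 ≤ τ0 m) (h1 : ∀ m, 0 ≤ τ1 m) (K : ℕ) :
    (((((if (0 : ℝ) < (τ0 0) then [((1 : Fin 3), (2 : Fin 3), ((τ0 0) : ℝ), (none : Option (Fin 1)))] else []) ++
        (if (0 : ℝ) < (τ1 0) then [((1 : Fin 3), (2 : Fin 3), ((τ1 0) : ℝ), some (0 : Fin 1))] else [])) ++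
      (List.range (K)).flatMap (fun k =>
        [((0 : Fin 3), (1 : Fin 3), (1 : ℝ), some (0 : Fin 1))] ++
        ((if (0 : ℝ) < (τ0 (k + 1)) then [((1 : Fin 3), (2 : Fin 3), ((τ0 (k + 1)) : ℝ), (none : Option (Fin 1)))] else []) ++
        (if (0 : ℝ) < (τ1 (k + 1)) then [((1 : Fin 3), (2 : Fin 3), ((τ1 (k + 1)) : ℝ), some (0 : Fin 1))] else [])) ++
        [((1 : Fin 3), (0 : Fin 3), (1 : ℝ), some (0 : Fin 1))]))).map (fun l : Fin 3 × Fin 3 × ℝ × Option (Fin 1) =>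
      Matrix.transvection l.1 l.2.1 (MvPolynomial.C l.2.2.1 * l.2.2.2.elim 1 MvPolynomial.X))).prod = ((Matrix.transvection (0 : Fin 3) (1 : Fin 3) (MvPolynomial.X (0 : Fin 1) : MvPolynomial (Fin 1) ℝ) *
        Matrix.transvection (1 : Fin 3) (0 : Fin 3) (MvPolynomial.X (0 : Fin 1) : MvPolynomial (Fin 1) ℝ)) ^ (K : ℕ)) + Matrix.vecMulVec ((∑ m ∈ Finset.range (K + 1), (MvPolynomial.C ((τ0 : ℕ → ℝ) (m)) + MvPolynomial.C ((τ1 : ℕ → ℝ) (m)) * (MvPolynomial.X (0 : Fin 1) : MvPolynomial (Fin 1) ℝ)) • (W : ℕ → Fin 3 → MvPolynomial (Fin 1) ℝ) (2 * m)) : Fin 3 → MvPolynomial (Fin 1) ℝ) (Pi.single (2 : Fin 3) (1 : MvPolynomial (Fin 1) ℝ)) := by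
  induction K with
  | zero =>
    simp only [List.range_zero, List.flatMap_nil, List.append_nil, pow_zero, List.map_append,
      List.prod_append]
    rw [utaps_prod _ _ (h0 0) (h1 0), ← one_mul (Matrix.transvection (1 : Fin 3) 2 _),
      u_mul_transvection_two]
    have h := (uA_col W hW 0).2
    simp only [pow_zero] at h
    rw [h]
    simp
  | succ K ih =>
    rw [utword_succ, List.map_append, List.prod_append, ih]
    simp only [List.map_append, List.map_cons, List.map_nil, List.prod_append,
      List.prod_cons, List.prod_nil, mul_one]
    rw [utaps_prod _ _ (h0 (K + 1)) (h1 (K + 1))]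
    simp only [Option.elim_some, map_one, one_mul]
    set ρ : (MvPolynomial (Fin 1) ℝ) := MvPolynomial.C (τ0 (K + 1)) + MvPolynomial.C (τ1 (K + 1)) * (MvPolynomial.X (0 : Fin 1) : MvPolynomial (Fin 1) ℝ) with hρ
    have step1 : (((Matrix.transvection (0 : Fin 3) (1 : Fin 3) (MvPolynomial.X (0 : Fin 1) : MvPolynomial (Fin 1) ℝ) *
        Matrix.transvection (1 : Fin 3) (0 : Fin 3) (MvPolynomial.X (0 : Fin 1) : MvPolynomial (Fin 1) ℝ)) ^ (K : ℕ)) + Matrix.vecMulVec ((∑ m ∈ Finset.range (K + 1), (MvPolynomial.C ((τ0 : ℕ → ℝ) (m)) + MvPolynomial.C ((τ1 : ℕ → ℝ) (m)) * (MvPolynomial.X (0 : Fin 1) : MvPolynomial (Fin 1) ℝ)) • (W : ℕ → Fin 3 → MvPolynomial (Fin 1) ℝ) (2 * m)) : Fin 3 → MvPolynomial (Fin 1) ℝ) (Pi.single (2 : Fin 3) (1 : MvPolynomial (Fin 1) ℝ))) * Matrix.transvection (0 : Fin 3) 1 (MvPolynomial.X (0 : Fin 1) : MvPolynomial (Fin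 1) ℝ) =
        ((Matrix.transvection (0 : Fin 3) (1 : Fin 3) (MvPolynomial.X (0 : Fin 1) : MvPolynomial (Fin 1) ℝ) *
        Matrix.transvection (1 : Fin 3) (0 : Fin 3) (MvPolynomial.X (0 : Fin 1) : MvPolynomial (Fin 1) ℝ)) ^ (K : ℕ)) * Matrix.transvection (0 : Fin 3) 1 (MvPolynomial.X (0 : Fin 1) : MvPolynomial (Fin 1) ℝ) + Matrix.vecMulVec ((∑ m ∈ Finset.range (K + 1), (MvPolynomial.C ((τ0 : ℕ → ℝ) (m)) + MvPolynomial.C ((τ1 : ℕ → ℝ) (m)) * (MvPolynomial.X (0 : Fin 1) : MvPolynomial (Fin 1) ℝ)) • (W : ℕ → Fin 3 → MvPolynomial (Fin 1) ℝ) (2 * m)) : Fin 3 → MvPolynomial (Fin 1) ℝ) (Pi.single (2 : Fin 3) (1 : MvPolynomial (Fin 1) ℝ)) := by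
      rw [add_mul, uG_mul_transvection _ _ _ (by decide)]
    have step2 : (((Matrix.transvection (0 : Fin 3) (1 : Fin 3) (MvPolynomial.X (0 : Fin 1) : MvPolynomial (Fin 1) ℝ) *
        Matrix.transvection (1 : Fin 3) (0 : Fin 3) (MvPolynomial.X (0 : Fin 1) : MvPolynomial (Fin 1) ℝ)) ^ (K : ℕ)) * Matrix.transvection (0 : Fin 3) 1 (MvPolynomial.X (0 : Fin 1) : MvPolynomial (Fin 1) ℝ) + Matrix.vecMulVec ((∑ m ∈ Finset.range (K + 1), (MvPolynomial.C ((τ0 : ℕ → ℝ) (m)) + MvPolynomial.C ((τ1 : ℕ → ℝ) (m)) * (MvPolynomial.X (0 : Fin 1) : MvPolynomial (Fin 1) ℝ)) • (W : ℕ → Fin 3 → MvPolynomial (Fin 1) ℝ) (2 * m)) : Fin 3 → MvPolynomial (Fin 1) ℝ) (Pi.single (2 : Fin 3) (1 : MvPolynomial (Fin 1) ℝ))) *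
        Matrix.transvection (1 : Fin 3) 2 ρ =
        ((Matrix.transvection (0 : Fin 3) (1 : Fin 3) (MvPolynomial.X (0 : Fin 1) : MvPolynomial (Fin 1) ℝ) *
        Matrix.transvection (1 : Fin 3) (0 : Fin 3) (MvPolynomial.X (0 : Fin 1) : MvPolynomial (Fin 1) ℝ)) ^ (K : ℕ)) * Matrix.transvection (0 : Fin 3) 1 (MvPolynomial.X (0 : Fin 1) : MvPolynomial (Fin 1) ℝ) + Matrix.vecMulVec ((∑ m ∈ Finset.range (K + 1), (MvPolynomial.C ((τ0 : ℕ → ℝ) (m)) + MvPolynomial.C ((τ1 : ℕ → ℝ) (m)) * (MvPolynomial.X (0 : Fin 1) : MvPolynomial (Fin 1) ℝ)) • (W : ℕ → Fin 3 → MvPolynomial (Fin 1) ℝ) (2 * m)) : Fin 3 → MvPolynomial (Fin 1) ℝ) (Pi.single (2 : Fin 3) (1 : MvPolynomial (Fin 1) ℝ)) +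
          Matrix.vecMulVec (ρ • W (2 * K + 2) : Fin 3 → MvPolynomial (Fin 1) ℝ) (Pi.single (2 : Fin 3) (1 : MvPolynomial (Fin 1) ℝ)) := by
      rw [u_mul_transvection_two]
      congr 2
      have : (fun r => (((Matrix.transvection (0 : Fin 3) (1 : Fin 3) (MvPolynomial.X (0 : Fin 1) : MvPolynomial (Fin 1) ℝ) *
        Matrix.transvection (1 : Fin 3) (0 : Fin 3) (MvPolynomial.X (0 : Fin 1) : MvPolynomial (Fin 1) ℝ)) ^ (K : ℕ)) * Matrix.transvection (0 : Fin 3) 1 (MvPolynomial.X (0 : Fin 1) : MvPolynomial (Fin 1) ℝ) + Matrix.vecMulVec ((∑ m ∈ Finset.range (K + 1), (MvPolynomial.C ((τ0 : ℕ → ℝ) (m)) + MvPolynomial.C ((τ1 : ℕ → ℝ) (m)) * (MvPolynomial.X (0 : Fin 1) : MvPolynomial (Fin 1) ℝ)) • (W : ℕ → Fin 3 → MvPolynomial (Fin 1) ℝ) (2 * m)) : Fin 3 → MvPolynomial (Fin 1) ℝ) (Pi.single (2 : Fin 3) (1 : MvPolynomial (Fin 1) ℝ))) r 1) =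
          (fun r => (((Matrix.transvection (0 : Fin 3) (1 : Fin 3) (MvPolynomial.X (0 : Fin 1) : MvPolynomial (Fin 1) ℝ) *
        Matrix.transvection (1 : Fin 3) (0 : Fin 3) (MvPolynomial.X (0 : Fin 1) : MvPolynomial (Fin 1) ℝ)) ^ (K : ℕ)) * Matrix.transvection (0 : Fin 3) 1 (MvPolynomial.X (0 : Fin 1) : MvPolynomial (Fin 1) ℝ)) r 1) +
          (fun r => Matrix.vecMulVec ((∑ m ∈ Finset.range (K + 1), (MvPolynomial.C ((τ0 : ℕ → ℝ) (m)) + MvPolynomial.C ((τ1 : ℕ → ℝ) (m)) * (MvPolynomial.X (0 : Fin 1) : MvPolynomial (Fin 1) ℝ)) • (W : ℕ → Fin 3 → MvPolynomial (Fin 1) ℝ) (2 * m)) : Fin 3 → MvPolynomial (Fin 1) ℝ) (Pi.single (2 : Fin 3) (1 : MvPolynomial (Fin 1) ℝ)) r 1) := by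
        funext r; simp [Matrix.add_apply]
      rw [this, (uA_x1_col W hW K).2, uG_col _ _ (by decide), add_zero]
    have step3 : (((Matrix.transvection (0 : Fin 3) (1 : Fin 3) (MvPolynomial.X (0 : Fin 1) : MvPolynomial (Fin 1) ℝ) *
        Matrix.transvection (1 : Fin 3) (0 : Fin 3) (MvPolynomial.X (0 : Fin 1) : MvPolynomial (Fin 1) ℝ)) ^ (K : ℕ)) * Matrix.transvection (0 : Fin 3) 1 (MvPolynomial.X (0 : Fin 1) : MvPolynomial (Fin 1) ℝ) + Matrix.vecMulVec ((∑ m ∈ Finset.range (K + 1), (MvPolynomial.C ((τ0 : ℕ → ℝ) (m)) + MvPolynomial.C ((τ1 : ℕ → ℝ) (m)) * (MvPolynomial.X (0 : Fin 1) : MvPolynomial (Fin 1) ℝ)) • (W : ℕ → Fin 3 → MvPolynomial (Fin 1) ℝ) (2 * m)) : Fin 3 → MvPolynomial (Fin 1) ℝ) (Pi.single (2 : Fin 3) (1 : MvPolynomial (Fin 1) ℝ)) +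
          Matrix.vecMulVec (ρ • W (2 * K + 2) : Fin 3 → MvPolynomial (Fin 1) ℝ) (Pi.single (2 : Fin 3) (1 : MvPolynomial (Fin 1) ℝ))) * Matrix.transvection (1 : Fin 3) 0 (MvPolynomial.X (0 : Fin 1) : MvPolynomial (Fin 1) ℝ) =
        ((Matrix.transvection (0 : Fin 3) (1 : Fin 3) (MvPolynomial.X (0 : Fin 1) : MvPolynomial (Fin 1) ℝ) *
        Matrix.transvection (1 : Fin 3) (0 : Fin 3) (MvPolynomial.X (0 : Fin 1) : MvPolynomial (Fin 1) ℝ)) ^ (K + 1 : ℕ)) + Matrix.vecMulVec ((∑ m ∈ Finset.range (K + 1 + 1), (MvPolynomial.C ((τ0 : ℕ → ℝ) (m)) + MvPolynomial.C ((τ1 : ℕ → ℝ) (m)) * (MvPolynomial.X (0 : Fin 1) : MvPolynomial (Fin 1) ℝ)) • (W : ℕ → Fin 3 → MvPolynomial (Fin 1) ℝ) (2 * m)) : Fin 3 → MvPolynomial (Fin 1) ℝ) (Pi.single (2 : Fin 3) (1 : MvPolynomial (Fin 1) ℝ)) := by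
      rw [add_mul, add_mul, uG_mul_transvection _ _ _ (by decide), uG_mul_transvection _ _ _ (by decide),
        ← uA_succ, uvec_succ W hW, Matrix.add_vecMulVec, add_assoc]
    rw [show ∀ (A X T Y : Matrix (Fin 3) (Fin 3) (MvPolynomial (Fin 1) ℝ)), A * (X * T * Y) = A * X * T * Y from
      fun A X T Y => by simp only [mul_assoc], step1, step2, step3]

end TapWords

section SandwichIdentity

/-- **The sandwich identity**: if the taps of `R` equal the taps of `Q₁` plus the (translated) taps of `Q₂`
plus `F · u(J)`, then `R = Q₁ · E₀₂(F) · Q₂` as matrices. [folklore] -/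
theorem stub_univariateSandwichIdentity (W : ℕ → Fin 3 → MvPolynomial (Fin 1) ℝ)
    (hW : W 0 = Pi.single 1 1 ∧ W 1 = Pi.single 0 1 ∧
      ∀ n, W (n + 2) = W n + (MvPolynomial.X (0 : Fin 1) : MvPolynomial (Fin 1) ℝ) • W (n + 1))
    (τR0 τR1 τ10 τ11 τ20 τ21 : ℕ → ℝ)
    (hR0 : ∀ m, 0 ≤ τR0 m) (hR1 : ∀ m, 0 ≤ τR1 m) (h10 : ∀ m, 0 ≤ τ10 m) (h11 : ∀ m, 0 ≤ τ11 m)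
    (h20 : ∀ m, 0 ≤ τ20 m) (h21 : ∀ m, 0 ≤ τ21 m) (J K : ℕ) (F : (MvPolynomial (Fin 1) ℝ))
    (hyp : (∑ m ∈ Finset.range (J + K + 1), (MvPolynomial.C ((τR0 : ℕ → ℝ) (m)) + MvPolynomial.C ((τR1 : ℕ → ℝ) (m)) * (MvPolynomial.X (0 : Fin 1) : MvPolynomial (Fin 1) ℝ)) • (W : ℕ → Fin 3 → MvPolynomial (Fin 1) ℝ) (2 * m)) =
      (∑ m ∈ Finset.range (J + 1), (MvPolynomial.C ((τ10 : ℕ → ℝ) (m)) + MvPolynomial.C ((τ11 : ℕ → ℝ) (m)) * (MvPolynomial.X (0 : Fin 1) : MvPolynomial (Fin 1) ℝ)) • (W : ℕ → Fin 3 → MvPolynomial (Fin 1) ℝ) (2 * m)) + Matrix.mulVec ((Matrix.transvection (0 : Fin 3) (1 : Fin 3) (MvPolynomial.X (0 : Fin 1) : MvPolynomial (Fin 1) ℝ) *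
        Matrix.transvection (1 : Fin 3) (0 : Fin 3) (MvPolynomial.X (0 : Fin 1) : MvPolynomial (Fin 1) ℝ)) ^ (J : ℕ)) (∑ m ∈ Finset.range (K + 1), (MvPolynomial.C ((τ20 : ℕ → ℝ) (m)) + MvPolynomial.C ((τ21 : ℕ → ℝ) (m)) * (MvPolynomial.X (0 : Fin 1) : MvPolynomial (Fin 1) ℝ)) • (W : ℕ → Fin 3 → MvPolynomial (Fin 1) ℝ) (2 * m)) + F • W (2 * J + 1)) :
    (((((if (0 : ℝ) < (τR0 0) then [((1 : Fin 3), (2 : Fin 3), ((τR0 0) : ℝ), (none : Option (Fin 1)))] else []) ++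
        (if (0 : ℝ) < (τR1 0) then [((1 : Fin 3), (2 : Fin 3), ((τR1 0) : ℝ), some (0 : Fin 1))] else [])) ++
      (List.range (J + K)).flatMap (fun k =>
        [((0 : Fin 3), (1 : Fin 3), (1 : ℝ), some (0 : Fin 1))] ++
        ((if (0 : ℝ) < (τR0 (k + 1)) then [((1 : Fin 3), (2 : Fin 3), ((τR0 (k + 1)) : ℝ), (none : Option (Fin 1)))] else []) ++
        (if (0 : ℝ) < (τR1 (k + 1)) then [((1 : Fin 3), (2 : Fin 3), ((τR1 (k + 1)) : ℝ), some (0 : Fin 1))] else [])) ++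
        [((1 : Fin 3), (0 : Fin 3), (1 : ℝ), some (0 : Fin 1))]))).map (fun l : Fin 3 × Fin 3 × ℝ × Option (Fin 1) =>
      Matrix.transvection l.1 l.2.1 (MvPolynomial.C l.2.2.1 * l.2.2.2.elim 1 MvPolynomial.X))).prod =
      (((((if (0 : ℝ) < (τ10 0) then [((1 : Fin 3), (2 : Fin 3), ((τ10 0) : ℝ), (none : Option (Fin 1)))] else []) ++
        (if (0 : ℝ) < (τ11 0) then [((1 : Fin 3), (2 : Fin 3), ((τ11 0) : ℝ), some (0 : Fin 1))] else [])) ++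
      (List.range (J)).flatMap (fun k =>
        [((0 : Fin 3), (1 : Fin 3), (1 : ℝ), some (0 : Fin 1))] ++
        ((if (0 : ℝ) < (τ10 (k + 1)) then [((1 : Fin 3), (2 : Fin 3), ((τ10 (k + 1)) : ℝ), (none : Option (Fin 1)))] else []) ++
        (if (0 : ℝ) < (τ11 (k + 1)) then [((1 : Fin 3), (2 : Fin 3), ((τ11 (k + 1)) : ℝ), some (0 : Fin 1))] else [])) ++
        [((1 : Fin 3), (0 : Fin 3), (1 : ℝ), some (0 : Fin 1))]))).map (fun l : Fin 3 × Fin 3 × ℝ × Option (Fin 1) =>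
      Matrix.transvection l.1 l.2.1 (MvPolynomial.C l.2.2.1 * l.2.2.2.elim 1 MvPolynomial.X))).prod * Matrix.transvection 0 2 F *
        (((((if (0 : ℝ) < (τ20 0) then [((1 : Fin 3), (2 : Fin 3), ((τ20 0) : ℝ), (none : Option (Fin 1)))] else []) ++
        (if (0 : ℝ) < (τ21 0) then [((1 : Fin 3), (2 : Fin 3), ((τ21 0) : ℝ), some (0 : Fin 1))] else [])) ++
      (List.range (K)).flatMap (fun k =>
        [((0 : Fin 3), (1 : Fin 3), (1 : ℝ), some (0 : Fin 1))] ++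
        ((if (0 : ℝ) < (τ20 (k + 1)) then [((1 : Fin 3), (2 : Fin 3), ((τ20 (k + 1)) : ℝ), (none : Option (Fin 1)))] else []) ++
        (if (0 : ℝ) < (τ21 (k + 1)) then [((1 : Fin 3), (2 : Fin 3), ((τ21 (k + 1)) : ℝ), some (0 : Fin 1))] else [])) ++
        [((1 : Fin 3), (0 : Fin 3), (1 : ℝ), some (0 : Fin 1))]))).map (fun l : Fin 3 × Fin 3 × ℝ × Option (Fin 1) =>
      Matrix.transvection l.1 l.2.1 (MvPolynomial.C l.2.2.1 * l.2.2.2.elim 1 MvPolynomial.X))).prod := by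
  rw [utword_prod W hW _ _ hR0 hR1, utword_prod W hW _ _ h10 h11, utword_prod W hW _ _ h20 h21]
  rw [add_mul, uG_mul_transvection _ _ _ (by decide), u_mul_transvection_two, (uA_col W hW J).1]
  have hA : ((Matrix.transvection (0 : Fin 3) (1 : Fin 3) (MvPolynomial.X (0 : Fin 1) : MvPolynomial (Fin 1) ℝ) *
        Matrix.transvection (1 : Fin 3) (0 : Fin 3) (MvPolynomial.X (0 : Fin 1) : MvPolynomial (Fin 1) ℝ)) ^ (J : ℕ)) * ((Matrix.transvection (0 : Fin 3) (1 : Fin 3) (MvPolynomial.X (0 : Fin 1) : MvPolynomial (Fin 1) ℝ) *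
        Matrix.transvection (1 : Fin 3) (0 : Fin 3) (MvPolynomial.X (0 : Fin 1) : MvPolynomial (Fin 1) ℝ)) ^ (K : ℕ)) = ((Matrix.transvection (0 : Fin 3) (1 : Fin 3) (MvPolynomial.X (0 : Fin 1) : MvPolynomial (Fin 1) ℝ) *
        Matrix.transvection (1 : Fin 3) (0 : Fin 3) (MvPolynomial.X (0 : Fin 1) : MvPolynomial (Fin 1) ℝ)) ^ (J + K : ℕ)) := (pow_add _ _ _).symm
  rw [add_mul, add_mul, mul_add, mul_add, mul_add, hA, Matrix.mul_vecMulVec,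
    uG_mul_of_row2 _ _ (uA_row2 K), uG_mul_of_row2 _ _ (uA_row2 K),
    uG_mul_uG _ _ (uvec_two W hW _ _ _), uG_mul_uG _ _ (uvec_two W hW _ _ _),
    add_zero, add_zero, hyp, Matrix.add_vecMulVec, Matrix.add_vecMulVec]
  abel

end SandwichIdentity

section TapBookkeeping

variable (W : ℕ → Fin 3 → MvPolynomial (Fin 1) ℝ)
  (hW : W 0 = Pi.single 1 1 ∧ W 1 = Pi.single 0 1 ∧
    ∀ n, W (n + 2) = W n + (MvPolynomial.X (0 : Fin 1) : MvPolynomial (Fin 1) ℝ) • W (n + 1))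
include hW

/-- Positive minus negative part of the signed taps. [folklore] -/
theorem urho_posPart (σ0 σ1 : ℕ → ℝ) (m : ℕ) :
    (MvPolynomial.C ((σ0⁺ : ℕ → ℝ) (m)) + MvPolynomial.C ((σ1⁺ : ℕ → ℝ) (m)) * (MvPolynomial.X (0 : Fin 1) : MvPolynomial (Fin 1) ℝ)) = (MvPolynomial.C ((σ0⁻ : ℕ → ℝ) (m)) + MvPolynomial.C ((σ1⁻ : ℕ → ℝ) (m)) * (MvPolynomial.X (0 : Fin 1) : MvPolynomial (Fin 1) ℝ)) + (MvPolynomial.C (σ0 m) + MvPolynomial.C (σ1 m) * (MvPolynomial.X (0 : Fin 1) : MvPolynomial (Fin 1) ℝ)) := by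
  have _ := hW
  have h0 : (σ0⁺) m = (σ0⁻) m + σ0 m := by
    have := congrFun (posPart_sub_negPart σ0) m
    simp only [Pi.sub_apply] at this
    linarith
  have h1 : (σ1⁺) m = (σ1⁻) m + σ1 m := by
    have := congrFun (posPart_sub_negPart σ1) m
    simp only [Pi.sub_apply] at this
    linarith
  rw [h0, h1, map_add, map_add]
  ring

/-- The walk matrix applied to a garbage vector translates its states. [folklore] -/
theorem uA_mulVec_uvec (τ0 τ1 : ℕ → ℝ) (J K : ℕ) :
    ((Matrix.transvection (0 : Fin 3) (1 : Fin 3) (MvPolynomial.X (0 : Fin 1) : MvPolynomial (Fin 1) ℝ) *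
        Matrix.transvection (1 : Fin 3) (0 : Fin 3) (MvPolynomial.X (0 : Fin 1) : MvPolynomial (Fin 1) ℝ)) ^ (J : ℕ)) *ᵥ (∑ m ∈ Finset.range (K + 1), (MvPolynomial.C ((τ0 : ℕ → ℝ) (m)) + MvPolynomial.C ((τ1 : ℕ → ℝ) (m)) * (MvPolynomial.X (0 : Fin 1) : MvPolynomial (Fin 1) ℝ)) • (W : ℕ → Fin 3 → MvPolynomial (Fin 1) ℝ) (2 * m)) =
      ∑ m ∈ Finset.range (K + 1), (MvPolynomial.C ((τ0 : ℕ → ℝ) (m)) + MvPolynomial.C ((τ1 : ℕ → ℝ) (m)) * (MvPolynomial.X (0 : Fin 1) : MvPolynomial (Fin 1) ℝ)) • W (2 * J + 2 * m) := by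
  rw [Matrix.mulVec_sum]
  refine Finset.sum_congr rfl (fun m _ => ?_)
  rw [Matrix.mulVec_smul, stub_univariateWalkTranslation W hW]

/-- **Tap bookkeeping**: the taps of `R` (positive parts) equal the taps of `Q₁` and `Q₂` (negative
parts, the latter translated by the walk of `Q₁`, state `J` itself belonging to `Q₁`) plus the signed
total `Σ_m σ_m · W(2m)`. [folklore] -/
theorem usplit (σ0 σ1 : ℕ → ℝ) (J K : ℕ) :
    (∑ m ∈ Finset.range (J + K + 1), (MvPolynomial.C ((σ0⁺ : ℕ → ℝ) (m)) + MvPolynomial.C ((σ1⁺ : ℕ → ℝ) (m)) * (MvPolynomial.X (0 : Fin 1) : MvPolynomial (Fin 1) ℝ)) • (W : ℕ → Fin 3 → MvPolynomial (Fin 1) ℝ) (2 * m)) =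
      (∑ m ∈ Finset.range (J + 1), (MvPolynomial.C ((σ0⁻ : ℕ → ℝ) (m)) + MvPolynomial.C ((σ1⁻ : ℕ → ℝ) (m)) * (MvPolynomial.X (0 : Fin 1) : MvPolynomial (Fin 1) ℝ)) • (W : ℕ → Fin 3 → MvPolynomial (Fin 1) ℝ) (2 * m)) +
        ((Matrix.transvection (0 : Fin 3) (1 : Fin 3) (MvPolynomial.X (0 : Fin 1) : MvPolynomial (Fin 1) ℝ) *
        Matrix.transvection (1 : Fin 3) (0 : Fin 3) (MvPolynomial.X (0 : Fin 1) : MvPolynomial (Fin 1) ℝ)) ^ (J : ℕ)) *ᵥ (∑ m ∈ Finset.range (K + 1), (MvPolynomial.C (((fun m => if m = 0 then 0 else (σ0⁻) (J + m)) : ℕ → ℝ) (m)) + MvPolynomial.C (((fun m => if m = 0 then 0 else (σ1⁻) (J + m)) : ℕ → ℝ) (m)) * (MvPolynomial.X (0 : Fin 1) : MvPolynomial (Fin 1) ℝ)) • (W : ℕ → Fin 3 → MvPolynomial (Fin 1) ℝ) (2 * m)) +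
        ∑ m ∈ Finset.range (J + K + 1),
          (MvPolynomial.C (σ0 m) + MvPolynomial.C (σ1 m) * (MvPolynomial.X (0 : Fin 1) : MvPolynomial (Fin 1) ℝ)) • W (2 * m) := by
  rw [uA_mulVec_uvec W hW, Finset.sum_range_succ' (fun m =>
    (MvPolynomial.C (((fun m => if m = 0 then 0 else (σ0⁻) (J + m)) : ℕ → ℝ) (m)) + MvPolynomial.C (((fun m => if m = 0 then 0 else (σ1⁻) (J + m)) : ℕ → ℝ) (m)) * (MvPolynomial.X (0 : Fin 1) : MvPolynomial (Fin 1) ℝ)) •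
      W (2 * J + 2 * m))]
  simp only [if_true, Nat.succ_ne_zero, if_false, map_zero, zero_mul, add_zero, zero_smul]
  have hneg : (∑ m ∈ Finset.range (J + 1), (MvPolynomial.C ((σ0⁻ : ℕ → ℝ) (m)) + MvPolynomial.C ((σ1⁻ : ℕ → ℝ) (m)) * (MvPolynomial.X (0 : Fin 1) : MvPolynomial (Fin 1) ℝ)) • (W : ℕ → Fin 3 → MvPolynomial (Fin 1) ℝ) (2 * m)) +
      ∑ x ∈ Finset.range K, (MvPolynomial.C ((σ0⁻ : ℕ → ℝ) (J + (x + 1))) + MvPolynomial.C ((σ1⁻ : ℕ → ℝ) (J + (x + 1))) * (MvPolynomial.X (0 : Fin 1) : MvPolynomial (Fin 1) ℝ)) • W (2 * J + 2 * (x + 1)) =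
      ∑ m ∈ Finset.range (J + K + 1), (MvPolynomial.C ((σ0⁻ : ℕ → ℝ) (m)) + MvPolynomial.C ((σ1⁻ : ℕ → ℝ) (m)) * (MvPolynomial.X (0 : Fin 1) : MvPolynomial (Fin 1) ℝ)) • W (2 * m) := by
    rw [show J + K + 1 = (J + 1) + K by ring,
      Finset.sum_range_add (fun m => (MvPolynomial.C ((σ0⁻ : ℕ → ℝ) (m)) + MvPolynomial.C ((σ1⁻ : ℕ → ℝ) (m)) * (MvPolynomial.X (0 : Fin 1) : MvPolynomial (Fin 1) ℝ)) • W (2 * m)) (J + 1) K]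
    congr 1
    refine Finset.sum_congr rfl (fun x _ => ?_)
    rw [show J + 1 + x = J + (x + 1) by ring, show 2 * (J + (x + 1)) = 2 * J + 2 * (x + 1) by ring]
  rw [hneg, ← Finset.sum_add_distrib]
  refine Finset.sum_congr rfl (fun m _ => ?_)
  rw [urho_posPart W hW, add_smul]

/-- The signed total for odd `d = a`: `Σ_m c·(-1)^(a+m) C(a,m) · W(2m) = (c t^a) · W(a)`. [folklore] -/
theorem utarget_odd (a : ℕ) (c : ℝ) :
    ∑ m ∈ Finset.range (a + 1),
      (MvPolynomial.C ((fun m => c * ((-1 : ℝ) ^ (a + m) * (a.choose m : ℝ))) m) +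
        MvPolynomial.C ((0 : ℕ → ℝ) m) * (MvPolynomial.X (0 : Fin 1) : MvPolynomial (Fin 1) ℝ)) • W (2 * m) =
      (MvPolynomial.C c * (MvPolynomial.X (0 : Fin 1) : MvPolynomial (Fin 1) ℝ) ^ a) • W a := by
  have hb := ubW_binomial (MvPolynomial.X (0 : Fin 1) : MvPolynomial (Fin 1) ℝ) W hW.2.2 a 0
  simp only [zero_add] at hb
  rw [mul_smul, hb, Finset.smul_sum]
  refine Finset.sum_congr rfl (fun m _ => ?_)
  simp only [Pi.zero_apply, map_zero, zero_mul, add_zero, map_mul, map_pow, map_neg, map_one,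
    map_natCast, smul_smul]

/-- The signed total for even `d = a + 1`: the same taps times `t`. [folklore] -/
theorem utarget_even (a : ℕ) (c : ℝ) :
    ∑ m ∈ Finset.range (a + 1),
      (MvPolynomial.C ((0 : ℕ → ℝ) m) +
        MvPolynomial.C ((fun m => c * ((-1 : ℝ) ^ (a + m) * (a.choose m : ℝ))) m) * (MvPolynomial.X (0 : Fin 1) : MvPolynomial (Fin 1) ℝ)) • W (2 * m) =
      (MvPolynomial.C c * (MvPolynomial.X (0 : Fin 1) : MvPolynomial (Fin 1) ℝ) ^ (a + 1)) • W a := by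
  have hb := ubW_binomial (MvPolynomial.X (0 : Fin 1) : MvPolynomial (Fin 1) ℝ) W hW.2.2 a 0
  simp only [zero_add] at hb
  rw [pow_succ, ← mul_assoc, mul_comm _ (MvPolynomial.X (0 : Fin 1) : MvPolynomial (Fin 1) ℝ), mul_smul, mul_smul, hb, Finset.smul_sum, Finset.smul_sum]
  refine Finset.sum_congr rfl (fun m _ => ?_)
  simp only [Pi.zero_apply, map_zero, zero_add, map_mul, map_pow, map_neg, map_one, map_natCast, smul_smul]
  ring_nf

end TapBookkeeping

end Summit.ValiantsHypothesis.ValiantsHypothesis.Cruxes.WordLengthQP.PositiveMonoidExits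

end
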